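import Summits.QuantumFields.YangMills.Theorems.LuscherReductionOneSiteLevelsGnQuasimode
import Summits.QuantumFields.YangMills.Theorems.LuscherReductionOneSiteLevelsTrial
import Summits.QuantumFields.YangMills.Theorems.LuscherReductionOneSiteLevelsNormaliser
import Summits.QuantumFields.YangMills.Theorems.FemtoTransferGapRungW1up
import Literature.Barriers.AtomisticToContinuum.DisorderedHarmonicChainTransfer

/-!
# AbsLower, preparatory inequalities: elementary real estimates and the per-trial-state bound
# (support module for the registered stub `stub_absLower` of crux `OneSiteLevels`, route `LuscherReduction`,
# item stmt-QuantumFields-20007; fleet seat prover ym-luscher-20007-p2)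

Elementary lemmas used to close the quasimode estimate: `e^{−t−2t²} ≤ 1 − t` on `[0,½]` (and the tree's `e^{−R} ≤ 6/R³`), the super-exponential
smallness of the cross-hemisphere term `e^{−15B/4}(2π²)³/√(π/B)⁹ ≤ K/B`, the normaliser identity `√(π/(Bμ²))⁹ μ⁹ = √(π/B)⁹`,
`Σ_{i,j}|a_i||a_j| ≤ (k+1)Σ_j a_j²`, and **`trial_estimate`**: for the eigenfunction data of `LuscherHamiltonianEigenfunctions k`
(smooth, orthonormal, eigen, decaying, with the quasimode constant `A` of `quasimode_estimate`) and `Bμ³ = 1/4`, `μ` small,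
`8e^{6B}Zc² · ‖G_a‖² · (1 − 2μE − μ²K) ≤ ⟨Ψ_a, K_B Ψ_a⟩` with an EXPLICIT `K = K(E, A, k, C_f, ∫e^{−‖y‖})`.

## WHAT THIS IS NOT
Bookkeeping; NOT THE CLAY GAP.  Sorry-free, no named fact (the eigenfunction data enter as hypotheses).
-/

set_option autoImplicit false

noncomputable section

open MeasureTheory Filter Topology Real
open scoped Matrix ENNReal
open Literature.MathematicalPhysics.QuantumFieldTheory
open Literature.MathematicalPhysics.QuantumLattice
open Literature.Analysis.OperatorTheory.YMMatrixModel

namespace Summit.QuantumFields.YangMills.Theorems.FemtoTransferGap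

/-! ### §1. Elementary real inequalities -/

/-- `e^{−t−2t²} ≤ 1 − t` for `0 ≤ t ≤ 1/2`. [folklore] -/
theorem exp_neg_sub_two_sq_le {t : ℝ} (h0 : 0 ≤ t) (h1 : t ≤ 1 / 2) : Real.exp (-t - 2 * t ^ 2) ≤ 1 - t := by
  have hu : 0 ≤ t + 2 * t ^ 2 := by positivity
  have h := Real.add_one_le_exp (t + 2 * t ^ 2)
  have hpos : 0 < t + 2 * t ^ 2 + 1 := by linarith
  rw [show -t - 2 * t ^ 2 = -(t + 2 * t ^ 2) by ring, Real.exp_neg]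
  rw [inv_le_comm₀ (Real.exp_pos _) (by linarith), ← one_div]
  calc 1 / (1 - t) ≤ t + 2 * t ^ 2 + 1 := by
        rw [div_le_iff₀ (by linarith)]
        nlinarith [sq_nonneg t, mul_nonneg (sq_nonneg t) h0]
    _ ≤ Real.exp (t + 2 * t ^ 2) := h

/-- The cross-hemisphere term is `O(1/B)`: for `B ≥ π`, `e^{−15B/4} · (2π²)³ / √(π/B)⁹ ≤ (8π⁶·720·(4/15)⁶/π⁵) / B`. [folklore] -/
theorem cross_term_le {B : ℝ} (hB : π ≤ B) :
    Real.exp (-(15 / 4 * B)) * (2 * π ^ 2) ^ 3 / Real.sqrt (π / B) ^ 9 ≤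
      (2 * π ^ 2) ^ 3 * 720 * (4 / 15) ^ 6 / π ^ 5 / B := by
  have hπ := Real.pi_pos
  have hB0 : 0 < B := lt_of_lt_of_le hπ hB
  set x := π / B with hx
  have hx0 : 0 < x := by positivity
  have hx1 : x ≤ 1 := by rw [hx, div_le_one hB0]; exact hB
  -- `√x⁹ ≥ x⁵` for `0 < x ≤ 1`
  have hsx : x ^ 5 ≤ Real.sqrt x ^ 9 := by
    have hs0 : 0 ≤ Real.sqrt x := Real.sqrt_nonneg x
    have hs1 : Real.sqrt x ≤ 1 := Real.sqrt_le_one.mpr hx1 |> fun h => by simpa using h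
    have hsq : Real.sqrt x ^ 2 = x := Real.sq_sqrt hx0.le
    have : x ^ 5 = Real.sqrt x ^ 10 := by rw [show (10:ℕ) = 2 * 5 by norm_num, pow_mul, hsq]
    rw [this, show (10:ℕ) = 9 + 1 by norm_num, pow_succ]
    exact mul_le_of_le_one_right (pow_nonneg hs0 9) hs1
  -- `e^{−u} ≤ 720/u⁶`, `u = 15B/4`
  have hu : 0 < 15 / 4 * B := by positivity
  have hexp : Real.exp (-(15 / 4 * B)) ≤ 720 / (15 / 4 * B) ^ 6 := by
    have h := Real.pow_div_factorial_le_exp (15 / 4 * B) hu.le 6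
    have h6 : ((6 : ℕ).factorial : ℝ) = 720 := by norm_num [Nat.factorial]
    rw [h6, div_le_iff₀ (by norm_num : (0:ℝ) < 720)] at h
    rw [Real.exp_neg, inv_le_comm₀ (Real.exp_pos _) (by positivity), show (720 / (15 / 4 * B) ^ 6)⁻¹ = (15 / 4 * B) ^ 6 / 720 by
      rw [inv_div]]
    linarith
  -- assemble: LHS ≤ (720/u⁶)(2π²)³/x⁵ = RHS
  have hx5 : 0 < x ^ 5 := by positivity
  calc Real.exp (-(15 / 4 * B)) * (2 * π ^ 2) ^ 3 / Real.sqrt (π / B) ^ 9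
      ≤ 720 / (15 / 4 * B) ^ 6 * (2 * π ^ 2) ^ 3 / x ^ 5 := by
        rw [← hx]
        have hs9 : 0 < Real.sqrt x ^ 9 := by positivity
        rw [div_le_div_iff₀ hs9 hx5]
        have h1 := mul_le_mul hexp hsx hx5.le (by positivity)
        have h0 : (0:ℝ) ≤ (2 * π ^ 2) ^ 3 := by positivity
        have h2 := mul_le_mul_of_nonneg_left h1 h0
        linarith
    _ = (2 * π ^ 2) ^ 3 * 720 * (4 / 15) ^ 6 / π ^ 5 / B := by
        rw [hx]
        field_simp

/-- The normaliser identity `√(π/(Bμ²))⁹ · μ⁹ = √(π/B)⁹` (`B, μ > 0`). [folklore] -/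
theorem sqrt_div_mul_sq_pow_mul (B μ : ℝ) (hB : 0 < B) (hμ : 0 < μ) :
    Real.sqrt (π / (B * μ ^ 2)) ^ 9 * μ ^ 9 = Real.sqrt (π / B) ^ 9 := by
  rw [← mul_pow]
  congr 1
  rw [show π / (B * μ ^ 2) = (π / B) / μ ^ 2 by field_simp, Real.sqrt_div' _ (sq_nonneg μ), Real.sqrt_sq hμ.le]
  field_simp

/-- `Σ_{i,j} |a_i||a_j| ≤ (k+1) Σ_j a_j²`. [folklore] -/
theorem sum_abs_mul_abs_le {k : ℕ} (a : Fin (k + 1) → ℝ) : ∑ i, ∑ j, |a i| * |a j| ≤ (k + 1) * ∑ j, a j ^ 2 := by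
  have e : ∑ i, ∑ j, |a i| * |a j| = (∑ j, |a j|) ^ 2 := by rw [sq, Finset.sum_mul_sum]
  rw [e]; exact sq_sum_abs_le a

/-- `√2⁹ ≤ 23`. [folklore] -/
theorem sqrt_two_pow_nine_le : Real.sqrt 2 ^ 9 ≤ 23 := by
  have h := Real.sq_sqrt (show (0:ℝ) ≤ 2 by norm_num)
  have h0 := Real.sqrt_nonneg 2
  have h1 : Real.sqrt 2 ≤ 23 / 16 := by nlinarith
  calc Real.sqrt 2 ^ 9 = (Real.sqrt 2 ^ 2) ^ 4 * Real.sqrt 2 := by ring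
    _ ≤ (Real.sqrt 2 ^ 2) ^ 4 * (23 / 16) := mul_le_mul_of_nonneg_left h1 (by positivity)
    _ = 23 := by rw [h]; norm_num

/-- `8/(3e) ≤ 8/3`. [folklore] -/
theorem kappa_le : 8 / (3 * Real.exp 1) ≤ 8 / 3 := by
  have he : 1 ≤ Real.exp 1 := Real.one_le_exp (by norm_num)
  exact div_le_div_of_nonneg_left (by norm_num) (by norm_num) (by linarith)

/-! ### §2. The per-trial-state estimate -/

section TrialEstimate

variable {k : ℕ} {f : Fin (k + 1) → ZM → ℝ}

/-- The explicit error constant of the trial estimate. [folklore] -/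
def absLowerK (E A Mom : ℝ) (k : ℕ) : ℝ :=
  48 * Mom + (4 * E + 4) + 18 * 98677656 * Mom + 736 * Mom + 21846 + 12288 * A * (k + 1)
    + 4 * ((2 * π ^ 2) ^ 3 * 720 * (4 / 15) ^ 6 / π ^ 5) * (7 / 8)

/-- `absLowerK ≥ 0` for nonnegative data. [folklore] -/
theorem absLowerK_nonneg {E A Mom : ℝ} (hE : 0 ≤ E) (hA : 0 ≤ A) (hM : 0 ≤ Mom) (k : ℕ) : 0 ≤ absLowerK E A Mom k := by
  unfold absLowerK; positivity

/-- **The per-trial-state estimate.**  Eigenfunction data `f` (smooth, colour-invariant, with decay `|f_j| ≤ C_f e^{−‖x‖}` and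
quasimode constant `A`), chart scale `μ` with `Bμ³ = 1/4` and the smallness conditions `μ ≤ 1/8`, `A(k+1)·3072μ³ ≤ 1/2`, `π ≤ B`;
cut-off radius `R = 1/(8μ)`.  Then for every coefficient vector `a`,
`8 e^{6B} Z c² ‖G_a‖² (1 − 2μE − μ²K) ≤ ⟨Ψ_a, K_B Ψ_a⟩`, `E = physLevel (k+1)`, `K = absLowerK E A ((k+1)C_f² ∫e^{−‖y‖}) k`. [folklore] -/
theorem trial_estimate (hsmooth : ∀ j, ∀ n : ℕ∞, ContDiff ℝ n (f j)) (hinv : ∀ j, IsGaugeInv (f j))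
    {Cf : ℝ} (hCf : ∀ j x, |f j x| ≤ Cf * Real.exp (-‖x‖))
    {A : ℝ} (hA0 : 0 ≤ A)
    (hq : ∀ R : ℝ, 1 ≤ R → ∀ a : Fin (k + 1) → ℝ,
      energyForm (radialCutoff R * fun x => ∑ j, a j * f j x) ≤
          physLevel (k + 1) * l2sq (radialCutoff R * fun x => ∑ j, a j * f j x) + A * Real.exp (-R) * ∑ i, ∑ j, |a i| * |a j| ∧
      ∑ j, a j ^ 2 - A * Real.exp (-R) * ∑ i, ∑ j, |a i| * |a j| ≤ l2sq (radialCutoff R * fun x => ∑ j, a j * f j x))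
    {B μ : ℝ} (hB : 0 < B) (hμ : 0 < μ) (hBμ : B * μ ^ 3 = 1 / 4) (hμ8 : μ ≤ 1 / 8) (hεμ : A * (k + 1) * (3072 * μ ^ 3) ≤ 1 / 2)
    (hBπ : π ≤ B) (a : Fin (k + 1) → ℝ) :
    8 * Real.exp (6 * B) * Real.sqrt (π / (B * μ ^ 2)) ^ 9 * (μ ^ 9 * ((2 * π ^ 2)⁻¹) ^ 3) ^ 2 *
        (∫ y, cutSpan f (1 / (8 * μ)) a y ^ 2) *
        (1 - 2 * μ * physLevel (k + 1) - μ ^ 2 * absLowerK (physLevel (k + 1)) A ((k + 1) * Cf ^ 2 * ∫ y : ZM, Real.exp (-‖y‖)) k) ≤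
      qform su2Rep B (trialMap f (1 / (8 * μ)) μ a) (trialMap f (1 / (8 * μ)) μ a) := by
  -- parameters and data
  have hR0 : 0 < 1 / (8 * μ) := by positivity
  have hR1 : 1 ≤ 1 / (8 * μ) := by rw [le_div_iff₀ (by positivity)]; linarith
  have hE0 : 0 ≤ physLevel (k + 1) := physLevel_nonneg (Nat.succ_le_succ (Nat.zero_le k))
  have hJ0 : 0 ≤ ∫ y : ZM, Real.exp (-‖y‖) := integral_nonneg fun y => (Real.exp_pos _).le
  have hMom0 : 0 ≤ (k + 1) * Cf ^ 2 * ∫ y : ZM, Real.exp (-‖y‖) := by positivity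
  obtain ⟨hGtest, hGinv⟩ := isTestFn_isGaugeInv_radialCutoff_mul_span hR0 hsmooth hinv a
  have hGeq : (radialCutoff (1 / (8 * μ)) * fun x => ∑ j, a j * f j x) = cutSpan f (1 / (8 * μ)) a := rfl
  rw [hGeq] at hGtest hGinv
  have hsupp : ∀ y, cutSpan f (1 / (8 * μ)) a y ≠ 0 → ‖y‖ ≤ Real.sqrt 2 * (1 / (8 * μ)) := fun y hy =>
    norm_le_of_cutSpan_ne_zero f hR0 a hy
  have hwin : μ ^ 2 * (Real.sqrt 2 * (1 / (8 * μ))) ^ 2 ≤ 1 / 16 := by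
    rw [sq_sqrt_two_mul]
    have : μ * (1 / (8 * μ)) = 1 / 8 := by field_simp
    rw [this]; norm_num
  have hμhalf : μ ≤ 1 / 2 := by linarith
  have hμ1 : μ ≤ 1 := by linarith
  -- the structural bound
  have hmain := qform_gnTrial_ge hB hμ hBμ hGtest hGinv hsupp hwin
  -- quasimode data
  obtain ⟨hq1, hq2⟩ := hq (1 / (8 * μ)) hR1 a
  rw [hGeq] at hq1 hq2
  have hl2sq : l2sq (cutSpan f (1 / (8 * μ)) a) = ∫ y, cutSpan f (1 / (8 * μ)) a y ^ 2 := rfl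
  rw [hl2sq] at hq1 hq2
  -- names for the real numbers involved (via `generalize`, so that all occurrences are syntactically uniform)
  have eT : trialMap f (1 / (8 * μ)) μ a = fun U => cutSpan f (1 / (8 * μ)) a (gnCoord μ U) := rfl
  rw [eT]
  generalize hGdef : cutSpan f (1 / (8 * μ)) a = G at hGtest hGinv hsupp hmain hq1 hq2 ⊢
  generalize hEdef : physLevel (k + 1) = E at hE0 hq1 ⊢
  generalize hJdef : ∫ y : ZM, Real.exp (-‖y‖) = J at hJ0 hMom0 ⊢
  have hn20 : 0 ≤ ∑ j, a j ^ 2 := Finset.sum_nonneg fun j _ => sq_nonneg _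
  have hN0 : 0 ≤ ∫ y, G y ^ 2 := integral_nonneg fun y => sq_nonneg _
  have hSn : ∑ i, ∑ j, |a i| * |a j| ≤ (k + 1) * ∑ j, a j ^ 2 := sum_abs_mul_abs_le a
  generalize hn2def : ∑ j, a j ^ 2 = n2 at hn20 hSn hq2 ⊢
  generalize hSdef : ∑ i, ∑ j, |a i| * |a j| = S at hSn hq1 hq2
  generalize hNdef : ∫ y, G y ^ 2 = N at hN0 hq1 hq2 hmain ⊢
  -- `e^{−R} ≤ 3072 μ³`, the tail `A e^{−R} S ≤ A(k+1)·3072μ³ · n2 ≤ n2/2`, and `n2 ≤ 2N`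
  have heR : Real.exp (-(1 / (8 * μ))) ≤ 3072 * μ ^ 3 := by
    refine (Literature.Barriers.AtomisticToContinuum.exp_neg_le_six_div_cube hR0).trans (le_of_eq ?_); field_simp; ring
  have hAS : A * Real.exp (-(1 / (8 * μ))) * S ≤ A * (k + 1) * (3072 * μ ^ 3) * n2 := by
    calc A * Real.exp (-(1 / (8 * μ))) * S ≤ A * Real.exp (-(1 / (8 * μ))) * ((k + 1) * n2) :=
          mul_le_mul_of_nonneg_left hSn (by positivity)
      _ ≤ A * (3072 * μ ^ 3) * ((k + 1) * n2) := by gcongr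
      _ = A * (k + 1) * (3072 * μ ^ 3) * n2 := by ring
  have hASn : A * (k + 1) * (3072 * μ ^ 3) * n2 ≤ (1 / 2) * n2 := mul_le_mul_of_nonneg_right hεμ hn20
  have hn2N : n2 ≤ 2 * N := by linarith only [hq2, hAS, hASn]
  -- moments of `G`
  have hM : ∀ m : ℕ, ∫ y, ‖y‖ ^ m * G y ^ 2 ≤ (m.factorial : ℝ) * ((k + 1) * Cf ^ 2 * J) * n2 := fun m => by
    rw [← hGdef, ← hJdef, ← hn2def]; exact integral_pow_mul_cutSpan_sq_le (f := f) hCf (1 / (8 * μ)) a m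
  generalize hMomdef : (k + 1) * Cf ^ 2 * J = Mom at hMom0 hM ⊢
  have hM2 := hM 2
  have hM6 := hM 6
  have hM10 := hM 10
  have f2 : ((2 : ℕ).factorial : ℝ) = 2 := by norm_num [Nat.factorial]
  have f6 : ((6 : ℕ).factorial : ℝ) = 720 := by norm_num [Nat.factorial]
  have f10 : ((10 : ℕ).factorial : ℝ) = 3628800 := by norm_num [Nat.factorial]
  rw [f2] at hM2; rw [f6] at hM6; rw [f10] at hM10
  have hM2' : ∫ y, ‖y‖ ^ 2 * G y ^ 2 ≤ 4 * Mom * N := by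
    calc ∫ y, ‖y‖ ^ 2 * G y ^ 2 ≤ 2 * Mom * n2 := hM2
      _ ≤ 2 * Mom * (2 * N) := mul_le_mul_of_nonneg_left hn2N (by positivity)
      _ = 4 * Mom * N := by ring
  have hm0 : 0 ≤ ∫ y, ‖y‖ ^ 2 * G y ^ 2 := integral_nonneg fun y => by positivity
  -- energy split and the gradient bound
  have hGc : Continuous G := hGtest.continuous
  have hG2s : HasCompactSupport fun y => G y ^ 2 := GaussForm.hasCompactSupport_sq hGtest.2
  have hD : Integrable fun y => ‖gradient G y‖ ^ 2 := by
    have hG1 : ContDiff ℝ 1 G := hGtest.1.of_le (by norm_num)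
    simp_rw [GaussForm.norm_gradient_eq]
    exact (((hG1.continuous_fderiv one_ne_zero).norm).pow 2).integrable_of_hasCompactSupport
      (GaussForm.hasCompactSupport_sq (hGtest.2.fderiv (𝕜 := ℝ)).norm)
  have hV : Integrable fun y => luscherPotential y * G y ^ 2 := hGtest.integrable_mul_sq continuous_luscherPotential
  have hEsplit : energyForm G = (1 / 2 : ℝ) * (∫ y, ‖gradient G y‖ ^ 2) + ∫ y, luscherPotential y * G y ^ 2 := by
    rw [energyForm, integral_add (hD.const_mul _) hV, integral_const_mul]
  have hVG0 : 0 ≤ ∫ y, luscherPotential y * G y ^ 2 := integral_nonneg fun y => mul_nonneg (luscherPotential_nonneg y) (sq_nonneg _)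
  have hDle : ∫ y, ‖gradient G y‖ ^ 2 ≤ 2 * (E * N) + 2 * N := by linarith only [hEsplit, hq1, hAS, hASn, hn2N, hVG0]
  -- the `gnLip` moment
  have hm : ∀ m : ℕ, Integrable fun y => ‖y‖ ^ m * G y ^ 2 := fun m =>
    ((continuous_norm.pow m).mul (hGc.pow 2)).integrable_of_hasCompactSupport hG2s.mul_left
  have hL : ∫ y, G y ^ 2 * gnLip B μ y ^ 2 ≤ μ ^ 2 * (98677656 * Mom * n2) := by
    have i1 : Integrable fun y => 108 * (‖y‖ ^ 2 * G y ^ 2) := (hm 2).const_mul _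
    have i2 : Integrable fun y => 972 * (‖y‖ ^ 6 * G y ^ 2) := (hm 6).const_mul _
    have i3 : Integrable fun y => 27 * (‖y‖ ^ 10 * G y ^ 2) := (hm 10).const_mul _
    have i12 : Integrable fun y => 108 * (‖y‖ ^ 2 * G y ^ 2) + 972 * (‖y‖ ^ 6 * G y ^ 2) := i1.add i2
    have i123 : Integrable fun y => 108 * (‖y‖ ^ 2 * G y ^ 2) + 972 * (‖y‖ ^ 6 * G y ^ 2) + 27 * (‖y‖ ^ 10 * G y ^ 2) := i12.add i3
    have hpt : ∀ y, G y ^ 2 * gnLip B μ y ^ 2 ≤ μ ^ 2 * (108 * (‖y‖ ^ 2 * G y ^ 2) + 972 * (‖y‖ ^ 6 * G y ^ 2) + 27 * (‖y‖ ^ 10 * G y ^ 2)) := by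
      intro y
      have := mul_le_mul_of_nonneg_left (gnLip_sq_le hμ hμhalf hBμ y) (sq_nonneg (G y))
      linarith only [this]
    calc ∫ y, G y ^ 2 * gnLip B μ y ^ 2 ≤ ∫ y, μ ^ 2 * (108 * (‖y‖ ^ 2 * G y ^ 2) + 972 * (‖y‖ ^ 6 * G y ^ 2) + 27 * (‖y‖ ^ 10 * G y ^ 2)) :=
          integral_mono_of_nonneg (ae_of_all _ fun y => by positivity) (i123.const_mul _) (ae_of_all _ hpt)
      _ = μ ^ 2 * (108 * (∫ y, ‖y‖ ^ 2 * G y ^ 2) + 972 * (∫ y, ‖y‖ ^ 6 * G y ^ 2) + 27 * ∫ y, ‖y‖ ^ 10 * G y ^ 2) := by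
          rw [integral_const_mul, integral_add i12 i3, integral_add i1 i2, integral_const_mul, integral_const_mul, integral_const_mul]
      _ ≤ μ ^ 2 * (98677656 * Mom * n2) := by
          refine mul_le_mul_of_nonneg_left ?_ (sq_nonneg μ)
          linarith only [hM2, hM6, hM10]
  -- `Bμ² = 1/(4μ)` hence `4/(e·Bμ²) ≤ 16μ`
  have hBμ2 : B * μ ^ 2 = 1 / (4 * μ) := by
    rw [eq_div_iff (by positivity)]; linear_combination 4 * hBμ
  have he1 : 1 ≤ Real.exp 1 := Real.one_le_exp (by norm_num)
  have hfrac : 4 / (Real.exp 1 * (B * μ ^ 2)) ≤ 16 * μ := by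
    rw [hBμ2, div_le_iff₀ (by positivity)]
    have e4 : 16 * μ * (Real.exp 1 * (1 / (4 * μ))) = 4 * Real.exp 1 := by field_simp; ring
    rw [e4]; linarith only [he1]
  have hκ := kappa_le
  have hκ0 : 0 ≤ 8 / (3 * Real.exp 1) := by positivity
  have hs2 := sqrt_two_pow_nine_le
  -- the five pieces of ERR, each `≤ μ² · const · N`
  have t1 : 12 * μ ^ 2 * (∫ y, ‖y‖ ^ 2 * G y ^ 2) ≤ μ ^ 2 * (48 * Mom * N) := by
    have := mul_le_mul_of_nonneg_left hM2' (sq_nonneg μ); linarith only [this]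
  have t2 : 2 * μ ^ 2 * (∫ y, ‖gradient G y‖ ^ 2) ≤ μ ^ 2 * ((4 * E + 4) * N) := by
    have := mul_le_mul_of_nonneg_left hDle (sq_nonneg μ); linarith only [this]
  have t3 : 9 * (μ + 1 / 2) * (∫ y, G y ^ 2 * gnLip B μ y ^ 2) ≤ μ ^ 2 * (18 * 98677656 * Mom * N) := by
    have hl0 : 0 ≤ ∫ y, G y ^ 2 * gnLip B μ y ^ 2 := integral_nonneg fun y => by positivity
    have h91 : 9 * (μ + 1 / 2) ≤ 9 := by linarith
    have a1 : 9 * (μ + 1 / 2) * (∫ y, G y ^ 2 * gnLip B μ y ^ 2) ≤ 9 * ∫ y, G y ^ 2 * gnLip B μ y ^ 2 :=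
      mul_le_mul_of_nonneg_right h91 hl0
    have a2 : μ ^ 2 * (98677656 * Mom * n2) ≤ μ ^ 2 * (98677656 * Mom * (2 * N)) :=
      mul_le_mul_of_nonneg_left (mul_le_mul_of_nonneg_left hn2N (by positivity)) (sq_nonneg μ)
    linarith only [a1, a2, hL]
  have t4 : μ ^ 2 * (8 / (3 * Real.exp 1)) * (3 * Real.sqrt 2 ^ 9 * (∫ y, ‖y‖ ^ 2 * G y ^ 2)) ≤ μ ^ 2 * (736 * Mom * N) := by
    have h1 : Real.sqrt 2 ^ 9 * (∫ y, ‖y‖ ^ 2 * G y ^ 2) ≤ 23 * (4 * Mom * N) := mul_le_mul hs2 hM2' hm0 (by norm_num)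
    have h2 : (8 / (3 * Real.exp 1)) * (3 * Real.sqrt 2 ^ 9 * (∫ y, ‖y‖ ^ 2 * G y ^ 2)) ≤ (8 / 3) * (3 * (23 * (4 * Mom * N))) :=
      mul_le_mul hκ (by linarith only [h1]) (mul_nonneg (by positivity) hm0) (by norm_num)
    have h3 := mul_le_mul_of_nonneg_left h2 (sq_nonneg μ)
    linarith only [h3]
  have t5 : μ ^ 2 * (8 / (3 * Real.exp 1)) * (2 * (4 / (Real.exp 1 * (B * μ ^ 2)) * (2 : ℝ) ^ 9) * N) ≤ μ ^ 2 * (21846 * N) := by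
    have h1 : 4 / (Real.exp 1 * (B * μ ^ 2)) * (2 : ℝ) ^ 9 ≤ 16 * μ * (2 : ℝ) ^ 9 := mul_le_mul_of_nonneg_right hfrac (by norm_num)
    have h2 : 2 * (4 / (Real.exp 1 * (B * μ ^ 2)) * (2 : ℝ) ^ 9) * N ≤ 2 * (16 * μ * (2 : ℝ) ^ 9) * N := by
      have := mul_le_mul_of_nonneg_right h1 hN0; linarith only [this]
    have h3 : 2 * (16 * μ * (2 : ℝ) ^ 9) * N ≤ 8192 * N := by
      have := mul_le_mul_of_nonneg_right hμhalf hN0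
      have e : 2 * (16 * μ * (2 : ℝ) ^ 9) * N = 16384 * (μ * N) := by ring
      rw [e]; linarith only [this]
    have h4 : (8 / (3 * Real.exp 1)) * (2 * (4 / (Real.exp 1 * (B * μ ^ 2)) * (2 : ℝ) ^ 9) * N) ≤ (8 / 3) * (8192 * N) :=
      mul_le_mul hκ (h2.trans h3) (mul_nonneg (by positivity) hN0) (by norm_num)
    have h5 := mul_le_mul_of_nonneg_left h4 (sq_nonneg μ)
    have hμN : 0 ≤ μ ^ 2 * N := mul_nonneg (sq_nonneg μ) hN0
    linarith only [h5, hμN]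
  -- the energy term
  have hEn : 2 * μ * energyForm G ≤ 2 * μ * (E * N) + μ ^ 2 * (12288 * A * (k + 1) * N) := by
    have h1 : energyForm G ≤ E * N + A * (k + 1) * (3072 * μ ^ 3) * n2 := by linarith only [hq1, hAS]
    have h2 : 2 * μ * energyForm G ≤ 2 * μ * (E * N + A * (k + 1) * (3072 * μ ^ 3) * n2) := mul_le_mul_of_nonneg_left h1 (by positivity)
    have h3 : A * (k + 1) * (3072 * μ ^ 3) * n2 ≤ A * (k + 1) * (3072 * μ ^ 3) * (2 * N) := mul_le_mul_of_nonneg_left hn2N (by positivity)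
    have hμ4 : μ ^ 4 ≤ μ ^ 2 := pow_le_pow_of_le_one hμ.le hμ1 (by norm_num)
    have h4 : 2 * μ * (A * (k + 1) * (3072 * μ ^ 3) * (2 * N)) = 12288 * A * (k + 1) * N * μ ^ 4 := by ring
    have h5 : 12288 * A * (k + 1) * N * μ ^ 4 ≤ 12288 * A * (k + 1) * N * μ ^ 2 := mul_le_mul_of_nonneg_left hμ4 (by positivity)
    have h6 := mul_le_mul_of_nonneg_left h3 (by positivity : 0 ≤ 2 * μ)
    linarith only [h2, h6, h4, h5]
  -- the cross term
  have hP0 : 0 < 8 * Real.exp (6 * B) * Real.sqrt (π / (B * μ ^ 2)) ^ 9 * (μ ^ 9 * ((2 * π ^ 2)⁻¹) ^ 3) ^ 2 := by positivity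
  have hZc : Real.sqrt (π / (B * μ ^ 2)) ^ 9 * (μ ^ 9 * ((2 * π ^ 2)⁻¹) ^ 3) = Real.sqrt (π / B) ^ 9 / (2 * π ^ 2) ^ 3 := by
    rw [← mul_assoc, sqrt_div_mul_sq_pow_mul B μ hB hμ]; ring
  have hct := cross_term_le hBπ
  have hKc0 : 0 ≤ (2 * π ^ 2) ^ 3 * 720 * (4 / 15) ^ 6 / π ^ 5 := by positivity
  have e1 : 7 * Real.exp (9 / 4 * B) * (μ ^ 9 * ((2 * π ^ 2)⁻¹) ^ 3) =
      (8 * Real.exp (6 * B) * Real.sqrt (π / (B * μ ^ 2)) ^ 9 * (μ ^ 9 * ((2 * π ^ 2)⁻¹) ^ 3) ^ 2) *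
        ((7 / 8) * (Real.exp (-(15 / 4 * B)) * (2 * π ^ 2) ^ 3 / Real.sqrt (π / B) ^ 9)) := by
    have e0 : 8 * Real.exp (6 * B) * Real.sqrt (π / (B * μ ^ 2)) ^ 9 * (μ ^ 9 * ((2 * π ^ 2)⁻¹) ^ 3) ^ 2 =
        8 * Real.exp (6 * B) * (Real.sqrt (π / (B * μ ^ 2)) ^ 9 * (μ ^ 9 * ((2 * π ^ 2)⁻¹) ^ 3)) * (μ ^ 9 * ((2 * π ^ 2)⁻¹) ^ 3) := by
      ring
    rw [e0, hZc]
    have hexp : Real.exp (9 / 4 * B) = Real.exp (6 * B) * Real.exp (-(15 / 4 * B)) := by rw [← Real.exp_add]; ring_nf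
    rw [hexp]
    have key : Real.sqrt (π / B) ^ 9 / (2 * π ^ 2) ^ 3 * ((2 * π ^ 2) ^ 3 / Real.sqrt (π / B) ^ 9) = 1 := by
      rw [div_mul_div_comm, mul_comm (Real.sqrt (π / B) ^ 9), div_self (by positivity)]
    rw [show 8 * Real.exp (6 * B) * (Real.sqrt (π / B) ^ 9 / (2 * π ^ 2) ^ 3) * (μ ^ 9 * ((2 * π ^ 2)⁻¹) ^ 3) *
        (7 / 8 * (Real.exp (-(15 / 4 * B)) * (2 * π ^ 2) ^ 3 / Real.sqrt (π / B) ^ 9)) =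
        7 * (Real.exp (6 * B) * Real.exp (-(15 / 4 * B))) * (μ ^ 9 * ((2 * π ^ 2)⁻¹) ^ 3) *
        (Real.sqrt (π / B) ^ 9 / (2 * π ^ 2) ^ 3 * ((2 * π ^ 2) ^ 3 / Real.sqrt (π / B) ^ 9)) by ring, key, mul_one]
  have e2 : (1 : ℝ) / B = 4 * μ ^ 3 := by
    have : B = 1 / (4 * μ ^ 3) := by rw [eq_div_iff (by positivity)]; linear_combination 4 * hBμ
    rw [this, one_div_one_div]
  -- abstract the large atoms
  generalize hKcdef : (2 * π ^ 2) ^ 3 * 720 * (4 / 15) ^ 6 / π ^ 5 = Kc at hct hKc0 ⊢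
  rw [div_eq_mul_one_div Kc B, e2] at hct
  generalize hXdef : Real.exp (-(15 / 4 * B)) * (2 * π ^ 2) ^ 3 / Real.sqrt (π / B) ^ 9 = X at hct e1
  generalize hPdef : 8 * Real.exp (6 * B) * Real.sqrt (π / (B * μ ^ 2)) ^ 9 * (μ ^ 9 * ((2 * π ^ 2)⁻¹) ^ 3) ^ 2 = P at hP0 hmain e1 ⊢
  generalize hcdef : μ ^ 9 * ((2 * π ^ 2)⁻¹) ^ 3 = c at e1 hmain
  have hμ32 : μ ^ 3 ≤ μ ^ 2 := pow_le_pow_of_le_one hμ.le hμ1 (by norm_num)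
  have h43 : 4 * μ ^ 3 ≤ 4 * μ ^ 2 := by linarith [hμ32]
  have hX : X ≤ Kc * (4 * μ ^ 2) := hct.trans (mul_le_mul_of_nonneg_left h43 hKc0)
  have hcross : 7 * Real.exp (9 / 4 * B) * c * N ≤ P * N * (μ ^ 2 * (4 * Kc * (7 / 8))) := by
    rw [e1]
    have hPN : 0 ≤ P * N := mul_nonneg hP0.le hN0
    have := mul_le_mul_of_nonneg_left hX hPN
    linarith only [this]
  -- put together
  have hERR : 12 * μ ^ 2 * (∫ y, ‖y‖ ^ 2 * G y ^ 2) + 2 * μ ^ 2 * (∫ y, ‖gradient G y‖ ^ 2)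
        + 9 * (μ + 1 / 2) * (∫ y, G y ^ 2 * gnLip B μ y ^ 2)
        + μ ^ 2 * (8 / (3 * Real.exp 1)) * (3 * Real.sqrt 2 ^ 9 * (∫ y, ‖y‖ ^ 2 * G y ^ 2)
          + 2 * (4 / (Real.exp 1 * (B * μ ^ 2)) * (2 : ℝ) ^ 9) * N) ≤
      μ ^ 2 * ((48 * Mom + (4 * E + 4) + 18 * 98677656 * Mom + 736 * Mom + 21846) * N) := by
    linarith only [t1, t2, t3, t4, t5]
  unfold absLowerK
  rw [hKcdef]
  have hfin := mul_le_mul_of_nonneg_left hERR hP0.le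
  have hfin2 := mul_le_mul_of_nonneg_left hEn hP0.le
  linarith only [hmain, hfin, hfin2, hcross]

end TrialEstimate

end Summit.QuantumFields.YangMills.Theorems.FemtoTransferGap

end
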